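import Mathlib
import Summits.MatrixMultiplication.MatrixMultiplication.Theorems.AutomaticSTPPDesignsNontrivialAllScalesFamily
import Summits.MatrixMultiplication.MatrixMultiplication.Theorems.AutomaticSTPPDesignsAutomaticPackingThesisPrattVal
import Literature.Combinatorics.Additive.TripleProductProperty
import Literature.Computability.AlgebraicComplexity.PrattTrapezoidVal
import Literature.Computability.AlgebraicComplexity.PrattTrapezoidValSTPP

/-!
# A quantitative growth exponent for Pratt's `Val(ℤ/nℤ)`: `Val(ℤ/nℤ) ≥ K · n^{log 9792 / log 5814}`

Support file for route `MatrixMultiplication/AutomaticSTPPDesigns`, crux `stmt-MatrixMultiplication-7356`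
(`AutomaticPackingThesis`), sharpening the companion file
`AutomaticSTPPDesignsAutomaticPackingThesisPrattVal.lean` (`prattVal_superlinear`: SOME `c > 0`, in fact
`c = log 141 / log 140 - 1 ≈ 1.4·10⁻³`, from the CKSU two-triple design in `ℤ/4 × ℤ/5 × ℤ/7 ≅ ℤ/140`).

The same three tree ingredients — the CKSU 2005 §5 coordinate design
(`NontrivialAllScalesFamily.addSimultaneousTPP_coordDesign`, generic in the three factors), lossless
digit-box powers inside one cyclic tower (`AutomaticPackingThesis.addSimultaneousTPP_digitBox`,
`AutomaticPackingThesis.sum_card_digitBox`) and the transfer to every modulus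
(`AutomaticPackingThesis.sum_card_le_prattVal_of_three_mul_le`, Pratt Prop. 3.3 / 4.3) — applied to
the factors `(17, 18, 19)` (pairwise coprime, `17·18·19 = 5814`) give an STPP digit design of mass
`2·16·17·18 = 9792` in `ℤ/5814`, hence `Val(ℤ/5814^k) ≥ 9792^k` and

  `prattVal_ge_rpow : ∃ K > 0, ∀ n ≥ 1, K · n^{log 9792 / log 5814} ≤ Val(ℤ/nℤ)`,

i.e. the growth exponent `θ = limsup log Val(ℤ/nℤ)/log n` satisfies `θ ≥ log 9792/log 5814 = 1.0601…`
(numerically; `(17,18,19)` maximises `log(2(h₁-1)(h₂-1)(h₃-1))/log(h₁h₂h₃)` over pairwise coprime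
triples below `60`; the two-triple family cannot pass `1 + log 2/(3 log h) → 1`).  For comparison, an
STPP family in an abelian group of order `N` has mass at most `N^{4/3}` (Hölder on Pratt's packing
bound Prop. 2.3), so lower bounds for `θ` obtained from STPP designs through Prop. 3.3 can never exceed
the `4/3` threshold of Pratt's Thm. 4.7.

## References

* K. Pratt, *On generalized corners and matrix multiplication*, ITCS 2024, arXiv:2309.03878: Def. 3.2,
  Prop. 3.3, Prop. 4.3, Conj. 4.1, Thm. 4.4, Thm. 4.7.
* H. Cohn, R. Kleinberg, B. Szegedy, C. Umans, FOCS 2005, arXiv:math/0511460, §5 (two-triple example).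
-/

-- single-conjunct summit: the mandated namespace repeats `MatrixMultiplication`.
set_option linter.dupNamespace false

noncomputable section

namespace Summit.MatrixMultiplication.MatrixMultiplication.Theorems

namespace PrattValExponent

open Finset Literature.Combinatorics.Additive Literature.Computability.AlgebraicComplexity
  Literature.Computability.AutomaticStructures NontrivialAllScalesFamily AutomaticPackingThesis

/-! ### The coordinate design in `ℤ/(h₁·(h₂·h₃))` for pairwise coprime factors -/

/-- **CKSU's two-triple design as a digit design in a cyclic group.** For pairwise coprime
`h₁, h₂, h₃` there are digit sets `(D^A_i, D^B_i, D^C_i)_{i ∈ Fin 2}` in `Fin (h₁(h₂h₃))` whose images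
in `ℤ/(h₁(h₂h₃))` form an STPP family of mass `2(h₁-1)(h₂-1)(h₃-1)`: the coordinate design of
`ℤ/h₁ × ℤ/h₂ × ℤ/h₃` carried along the Chinese remainder isomorphism (a sum-reflecting map).
[cite: CohnKleinbergSzegedyUmans2005, §5] -/
theorem exists_digitDesign_coprime (h₁ h₂ h₃ : ℕ) [NeZero h₁] [NeZero h₂] [NeZero h₃]
    (h12 : Nat.Coprime h₁ h₂) (h13 : Nat.Coprime h₁ h₃) (h23 : Nat.Coprime h₂ h₃) :
    ∃ DA DB DC : Fin 2 → Finset (Fin (h₁ * (h₂ * h₃))),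
    AddSimultaneousTPP
      (fun i => (DA i).image fun d : Fin (h₁ * (h₂ * h₃)) => ((d : ℕ) : ZMod (h₁ * (h₂ * h₃))))
      (fun i => (DB i).image fun d : Fin (h₁ * (h₂ * h₃)) => ((d : ℕ) : ZMod (h₁ * (h₂ * h₃))))
      (fun i => (DC i).image fun d : Fin (h₁ * (h₂ * h₃)) => ((d : ℕ) : ZMod (h₁ * (h₂ * h₃)))) ∧
    ∑ i, (DA i).card * (DB i).card * (DC i).card = 2 * ((h₁ - 1) * (h₂ - 1) * (h₃ - 1)) := by
  set N : ℕ := h₁ * (h₂ * h₃) with hN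
  haveI : NeZero N := ⟨by rw [hN]; exact mul_ne_zero (NeZero.ne _) (mul_ne_zero (NeZero.ne _) (NeZero.ne _))⟩
  -- the Chinese remainder isomorphism `ℤ/N ≃ ℤ/h₁ × (ℤ/h₂ × ℤ/h₃)`, as a sum-reflecting map
  obtain ⟨φ, hφ⟩ : ∃ φ : ZMod h₁ × (ZMod h₂ × ZMod h₃) → ZMod N,
      ∀ a b c a' b' c', φ a + φ b + φ c = φ a' + φ b' + φ c' → a + b + c = a' + b' + c' := by
    have h1 : Nat.Coprime h₁ (h₂ * h₃) := Nat.Coprime.mul_right h12 h13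
    let e : ZMod N ≃+ ZMod h₁ × (ZMod h₂ × ZMod h₃) :=
      (ZMod.chineseRemainder h1).toAddEquiv.trans
        (AddEquiv.prodCongr (AddEquiv.refl (ZMod h₁)) (ZMod.chineseRemainder h23).toAddEquiv)
    exact ⟨e.symm, fun a b c a' b' c' h => by simpa using congrArg e h⟩
  have hφinj := Literature.Computability.AlgebraicComplexity.injective_of_reflect φ hφ
  -- read the elements of `ℤ/N` as digits `Fin N`
  obtain ⟨ψ, hψ⟩ : ∃ ψ : ZMod h₁ × (ZMod h₂ × ZMod h₃) → Fin N,
      ∀ x, (((ψ x : Fin N) : ℕ) : ZMod N) = φ x :=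
    ⟨fun x => ⟨(φ x).val, ZMod.val_lt _⟩, fun x => ZMod.natCast_zmod_val (φ x)⟩
  have hψinj : Function.Injective ψ := fun x y h => hφinj (by rw [← hψ x, ← hψ y, h])
  have himg : ∀ s : Finset (ZMod h₁ × (ZMod h₂ × ZMod h₃)),
      (s.image ψ).image (fun d : Fin N => ((d : ℕ) : ZMod N)) = s.image φ := by
    intro s
    rw [Finset.image_image]
    exact Finset.image_congr fun x _ => hψ x
  have design := addSimultaneousTPP_coordDesign (H₁ := ZMod h₁) (H₂ := ZMod h₂) (H₃ := ZMod h₃)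
  refine ⟨fun i => (![(univ.erase 0).image fun x : ZMod h₁ => (x, (0 : ZMod h₂), (0 : ZMod h₃)),
        (univ.erase 0).image fun y : ZMod h₂ => ((0 : ZMod h₁), y, (0 : ZMod h₃))] i).image ψ,
      fun i => (![(univ.erase 0).image fun y : ZMod h₂ => ((0 : ZMod h₁), y, (0 : ZMod h₃)),
        (univ.erase 0).image fun z : ZMod h₃ => ((0 : ZMod h₁), (0 : ZMod h₂), z)] i).image ψ,
      fun i => (![(univ.erase 0).image fun z : ZMod h₃ => ((0 : ZMod h₁), (0 : ZMod h₂), z),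
        (univ.erase 0).image fun x : ZMod h₁ => (x, (0 : ZMod h₂), (0 : ZMod h₃))] i).image ψ,
      ?_, ?_⟩
  · simp only [himg]
    exact Literature.Computability.AlgebraicComplexity.addSimultaneousTPP_image_of_reflect
      design φ hφ
  · have i1 : Function.Injective fun x : ZMod h₁ => (x, (0 : ZMod h₂), (0 : ZMod h₃)) :=
      fun a b h => by simpa using h
    have i2 : Function.Injective fun y : ZMod h₂ => ((0 : ZMod h₁), y, (0 : ZMod h₃)) :=
      fun a b h => by simpa using h
    have i3 : Function.Injective fun z : ZMod h₃ => ((0 : ZMod h₁), (0 : ZMod h₂), z) :=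
      fun a b h => by simpa using h
    simp only [Fin.sum_univ_two, Matrix.cons_val_zero, Matrix.cons_val_one,
      card_image_of_injective _ hψinj, card_image_of_injective _ i1,
      card_image_of_injective _ i2, card_image_of_injective _ i3,
      card_erase_of_mem (mem_univ _), card_univ, ZMod.card]
    ring

/-! ### The `5814`-tower: mass `9792^k` at scale `k` -/

/-- **The `(17,18,19)` design as digits of `ℤ/5814`**: an STPP digit family of mass `9792` in
`ℤ/5814` (`5814 = 17·18·19`, `9792 = 2·16·17·18`). [cite: CohnKleinbergSzegedyUmans2005, §5] -/
theorem exists_digitDesign_5814 : ∃ DA DB DC : Fin 2 → Finset (Fin 5814),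
    AddSimultaneousTPP
      (fun i => (DA i).image fun d : Fin 5814 => ((d : ℕ) : ZMod 5814))
      (fun i => (DB i).image fun d : Fin 5814 => ((d : ℕ) : ZMod 5814))
      (fun i => (DC i).image fun d : Fin 5814 => ((d : ℕ) : ZMod 5814)) ∧
    ∑ i, #(DA i) * #(DB i) * #(DC i) = 9792 := by
  haveI : NeZero (17 : ℕ) := ⟨by norm_num⟩
  haveI : NeZero (18 : ℕ) := ⟨by norm_num⟩
  haveI : NeZero (19 : ℕ) := ⟨by norm_num⟩
  obtain ⟨DA, DB, DC, hD, hmass⟩ := exists_digitDesign_coprime 17 18 19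
    (by norm_num) (by norm_num) (by norm_num)
  exact ⟨DA, DB, DC, hD, by rw [hmass]⟩

/-- **An STPP family of mass `9792^k` in `ℤ/5814^k`, for every `k`**: the digit boxes over the
`(17,18,19)` coordinate design. [folklore] -/
theorem exists_design_pow_5814 (k : ℕ) :
    ∃ (n : ℕ) (A B C : Fin n → Finset (ZMod (5814 ^ k))),
      AddSimultaneousTPP A B C ∧ ∑ i, #(A i) * #(B i) * #(C i) = 9792 ^ k := by
  classical
  obtain ⟨DA, DB, DC, hD, hmass⟩ := exists_digitDesign_5814
  haveI : NeZero (5814 : ℕ) := ⟨by norm_num⟩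
  -- the digit-box family at scale `k`, reindexed along `Fin n ≃ (Fin k → Fin 2)`
  set e : Fin (Fintype.card (Fin k → Fin 2)) ≃ (Fin k → Fin 2) :=
    (Fintype.equivFin (Fin k → Fin 2)).symm with he
  have hS := (addSimultaneousTPP_digitBox DA DB DC hD k).comp e.injective
  refine ⟨Fintype.card (Fin k → Fin 2), _, _, _, hS, ?_⟩
  rw [← hmass, ← sum_card_digitBox DA DB DC k]
  exact e.sum_comp (fun w : Fin k → Fin 2 =>
    #((Fintype.piFinset fun j => DA (w j)).image
        fun a : Fin k → Fin 5814 => (digitValue a : ZMod (5814 ^ k))) *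
      #((Fintype.piFinset fun j => DB (w j)).image
        fun a : Fin k → Fin 5814 => (digitValue a : ZMod (5814 ^ k))) *
      #((Fintype.piFinset fun j => DC (w j)).image
        fun a : Fin k → Fin 5814 => (digitValue a : ZMod (5814 ^ k))))

/-- **`Val` along the `5814`-tower**: `9792^k ≤ Val(ℤ/N)` for every `N ≥ 3·5814^k`.
[cite: Pratt2024, Prop. 3.3 and Prop. 4.3] -/
theorem pow_le_prattVal_5814 (k N : ℕ) [NeZero N] (hN : 3 * 5814 ^ k ≤ N) :
    9792 ^ k ≤ prattVal (ZMod N) := by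
  obtain ⟨n, A, B, C, hS, hsum⟩ := exists_design_pow_5814 k
  haveI : NeZero (5814 ^ k) := ⟨pow_ne_zero _ (by norm_num)⟩
  rw [← hsum]
  exact sum_card_le_prattVal_of_three_mul_le hS hN

/-! ### The exponent -/

/-- **`Val(ℤ/nℤ) ≥ K · n^{log 9792 / log 5814}` for all `n ≥ 1`** (`log 9792 / log 5814 = 1.0601…`):
with `σ = log 9792 / log 5814`, `5814^σ = 9792`, so for `n ≥ 3·5814` and `5814^k ≤ n/3 < 5814^(k+1)`
we get `Val(ℤ/nℤ) ≥ 9792^k = (5814^k)^σ ≥ (n/34884)^σ`, and for smaller `n`,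
`Val(ℤ/nℤ) ≥ n ≥ (n/34884)^σ`; `K = 34884^{-σ}`. [folklore] -/
theorem prattVal_ge_rpow : ∃ K : ℝ, 0 < K ∧ ∀ (n : ℕ) (_ : NeZero n),
    K * (n : ℝ) ^ (Real.log 9792 / Real.log 5814) ≤ (prattVal (ZMod n) : ℝ) := by
  have hb : (1 : ℝ) < 5814 := by norm_num
  have hlogb : 0 < Real.log 5814 := Real.log_pos hb
  have hlogm : Real.log 5814 < Real.log 9792 := Real.log_lt_log (by norm_num) (by norm_num)
  set σ : ℝ := Real.log 9792 / Real.log 5814 with hσ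
  have h1σ : 1 < σ := by
    rw [hσ, lt_div_iff₀ hlogb, one_mul]
    exact hlogm
  have hσpos : 0 < σ := by linarith
  -- `5814^σ = 9792`, hence `(5814^k)^σ = 9792^k`
  have hpow : ∀ k : ℕ, (((5814 : ℕ) ^ k : ℕ) : ℝ) ^ σ = ((9792 ^ k : ℕ) : ℝ) := by
    intro k
    have hbm : (5814 : ℝ) ^ σ = 9792 := by
      rw [Real.rpow_def_of_pos (by norm_num : (0 : ℝ) < 5814)]
      have : Real.log 5814 * σ = Real.log 9792 := by
        rw [hσ]; field_simp
      rw [this, Real.exp_log (by norm_num)]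
    push_cast
    rw [← Real.rpow_natCast, ← Real.rpow_mul (by norm_num : (0 : ℝ) ≤ 5814), mul_comm,
      Real.rpow_mul (by norm_num : (0 : ℝ) ≤ 5814), hbm, Real.rpow_natCast]
  refine ⟨(1 / 34884 : ℝ) ^ σ, Real.rpow_pos_of_pos (by norm_num) _, ?_⟩
  intro n hn
  have hn1 : 1 ≤ n := Nat.one_le_iff_ne_zero.2 (NeZero.ne n)
  have hnR : (1 : ℝ) ≤ n := by exact_mod_cast hn1
  have hK : (1 / 34884 : ℝ) ^ σ * (n : ℝ) ^ σ = ((n : ℝ) / 34884) ^ σ := by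
    rw [← Real.mul_rpow (by norm_num) (by positivity)]
    congr 1
    ring
  rw [hK]
  by_cases hsmall : n < 17442
  · -- small moduli: `Val ≥ |G| = n ≥ n/34884 ≥ (n/34884)^σ`
    have hle1 : (n : ℝ) / 34884 ≤ 1 := by
      rw [div_le_one (by norm_num)]
      exact_mod_cast (by omega : n ≤ 34884)
    have hpos : 0 < (n : ℝ) / 34884 := by positivity
    calc ((n : ℝ) / 34884) ^ σ ≤ ((n : ℝ) / 34884) ^ (1 : ℝ) :=
          Real.rpow_le_rpow_of_exponent_ge hpos hle1 h1σ.le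
      _ = (n : ℝ) / 34884 := Real.rpow_one _
      _ ≤ n := by
          rw [div_le_iff₀ (by norm_num)]
          nlinarith
      _ = (Fintype.card (ZMod n) : ℝ) := by rw [ZMod.card]
      _ ≤ (prattVal (ZMod n) : ℝ) := by exact_mod_cast card_le_prattVal
  · -- large moduli: `5814^k ≤ n/3 < 5814^(k+1)`
    push Not at hsmall
    set k : ℕ := Nat.log 5814 (n / 3) with hk
    have hn3 : n / 3 ≠ 0 := by omega
    have hlow : 5814 ^ k ≤ n / 3 := Nat.pow_log_le_self 5814 hn3
    have hup : n / 3 < 5814 ^ (k + 1) := Nat.lt_pow_succ_log_self (by norm_num) _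
    have h3 : 3 * 5814 ^ k ≤ n := by omega
    have hval := pow_le_prattVal_5814 k n h3
    have hnb : (n : ℝ) / 34884 ≤ (((5814 : ℕ) ^ k : ℕ) : ℝ) := by
      rw [div_le_iff₀ (by norm_num)]
      have : n ≤ 5814 ^ k * 34884 := by
        have : n < 3 * 5814 ^ (k + 1) + 3 := by omega
        rw [pow_succ] at this
        omega
      exact_mod_cast this
    calc ((n : ℝ) / 34884) ^ σ ≤ (((5814 : ℕ) ^ k : ℕ) : ℝ) ^ σ :=
          Real.rpow_le_rpow (by positivity) hnb hσpos.le
      _ = ((9792 ^ k : ℕ) : ℝ) := hpow k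
      _ ≤ (prattVal (ZMod n) : ℝ) := by exact_mod_cast hval

/-- The exponent is a genuine power gain: `1 < log 9792 / log 5814`. [folklore] -/
theorem one_lt_exponent : (1 : ℝ) < Real.log 9792 / Real.log 5814 := by
  have hlogb : 0 < Real.log 5814 := Real.log_pos (by norm_num)
  rw [lt_div_iff₀ hlogb, one_mul]
  exact Real.log_lt_log (by norm_num) (by norm_num)

end PrattValExponent

end Summit.MatrixMultiplication.MatrixMultiplication.Theorems

end
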